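import Summits.QuantumFields.YangMills.Theorems.AllWindowsColdBoxBoxHighLineOrbitMapContractionPrelims
import Summits.QuantumFields.YangMills.Theorems.AllWindowsColdBoxBoxHighLineSmearedFPOperatorFloor
import Summits.QuantumFields.YangMills.Theorems.AllWindowsColdBoxBoxHighLineSmearedFPOrbitJacobian
import Literature.Analysis.Matrix.DetExp

/-!
# TASK T-S5.4J, brick J2: `theorem orbitMapContraction : OrbitMapContraction` (BY NAME) — the contraction estimate

Planner ym-idea-2 g18 (2026-08-29T18:11:01Z), `Cruxes/BoxWindowHighSU2213/TaskS5Laplace.lean` = ✓`…OrbitJacobianDefs.OrbitMapContraction`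
(fcl-p3's byte-for-byte copy; J2, owner w2): `‖(1 − F_V⁻¹·DΨ_V(v)) w‖₂ ≤ C·H²·a·‖w‖₂` on the sup-box `‖A_x‖ ≤ a ≤ 1`, for base points `V`
with cold-box links within defect `r₀²` of `1`, `C·r₀·H² ≤ 1` (then `F_V` is invertible).

With `W = V^{pauliGauge A}` and `DΨ_V(v) = F(W)·J` (w3's J1 ✓`OrbitChart.hasFDerivAt_orbitMapFlat_matrix`, `J = pauliJac H v` = the block sum of
the flat right-trivialised chart Jacobians, ✓`OrbitChart.jBlock_apply`/`OrbitChart.su2Coord_jPauli`: `X((Jw)_y) = gSer(ad(−X A_y))(X(w_y))`), the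
estimate is the algebra `1 − F_V⁻¹F(W)J = (1 − J) + F_V⁻¹(F_V − F(W))J` (✓`contraction_opBound`, `…OrbitMapContractionPrelims`):

* `fpOperator_inv_of_linkDefect` — base point: `2016·r₀·H² ≤ 1` ⇒ `IsUnit (det F_V)` and `‖F_V⁻¹ w‖₂² ≤ (8H²)²‖w‖₂²`
  (✓4c-E `fpOperator_sub_one_opBound_of_linkDefect`, `m = 252 r₀ ≤ 1/(8H²)`, into w4's ✓`SpectralFloor.fpOperator_inv_of_sub_one`);
* `mulVec_opBound_of_one_sub` — `‖1 − J‖ ≤ ε ⇒ ‖J‖ ≤ 1 + ε`;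
* **`orbitMap_contraction_core`** — for ANY matrix `J` with `‖(1 − J)w‖₂ ≤ c_J·a·‖w‖₂`:
  `‖(1 − F_V⁻¹·F(V^{pauliGauge A})·J) w‖₂² ≤ ((c_J + 16128(1 + c_J))·H²·a)²·‖w‖₂²` (`k = 8H²`, `m = 2016a` from ✓`fpOperator_pauliGauge_sub_opBound`,
  `j = 1 + c_J a`);
* `sum_sq_le_two_mul_norm_su2Coord_sq` (`Σ_c x_c² ≤ 2‖X(x)‖²`), `exp_six_mul_sub_one_le` (`e^{6s} − 1 ≤ 404 s` on `[0,1]`),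
  **`jacBlock_sub_sq_le`** — if `X(z) = gSer(ad(−X(A)))(X(u))` and `‖A‖ ≤ s ≤ 1` then `Σ_c (z_c − u_c)² ≤ (858 s)²·Σ_c u_c²`
  (✓`norm_gSer_sub_one_le`, ✓`norm_ad_le`, ✓`Parity.norm_su2Coord_le`), and its block-diagonal sum `one_sub_jac_opBound` (`c_J = 858`);
* `orbitMapContraction_of_hasFDerivAt` — the Prop from ANY derivative formula of that shape (matrix letters), `C = 858 + 16128·859`;
* ★★ **`orbitMapContraction : OrbitMapContraction`** — the instance at w3's export (`pauliJac_mulVec_slice`).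

HONEST LABEL: one brick (J2) of T-S5.4J; T-S5.4J itself (builder fcl-p3), S5, U5, ⟨24004⟩ ⟨24335⟩ ⟨24336⟩ remain OPEN; no crux, rung or
summit is proved; the Yang–Mills mass gap is NOT proved by this file.
-/

set_option autoImplicit false

noncomputable section

open Matrix Finset NormedSpace
open scoped Matrix.Norms.Operator
open Literature.MathematicalPhysics.QuantumFieldTheory.Balaban1983to89.B10Eq18SigmaSU2 (su2Coord)
open Literature.MathematicalPhysics.QuantumFieldTheory.Balaban1983to89.B10Eq18SigmaSU2Haar (expPauli)
open Literature.MathematicalPhysics.QuantumFieldTheory.AxialGauge (boxEdges)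
open Literature.MathematicalPhysics.QuantumLattice (LGConfig ZdEdge gaugeTransformZd)
open Literature.Probability.LatticeModels (Site)
open Literature.Analysis.Calculus.ExpDifferential (gSer ad norm_gSer_sub_one_le norm_ad_le)

namespace Summit.QuantumFields.YangMills.Theorems.AllWindowsColdBoxBoxHighLine


/-! ## The base point: invertibility and `‖F_V⁻¹‖₂ ≤ 8H²` -/

/-- **Base-point invertibility.**  If the cold-box links of `V` are within defect `r₀²` of the identity and `2016·r₀·H² ≤ 1` (`H ≥ 1`),
then `fpOperator H V` is invertible and `‖F_V⁻¹ w‖₂² ≤ (8H²)²·‖w‖₂²`. -/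
theorem fpOperator_inv_of_linkDefect {H : ℕ} (hH : 1 ≤ H) (V : LGConfig 4 SU2) {r₀ : ℝ} (hr₀ : 0 ≤ r₀)
    (hsmall : 2016 * r₀ * (H : ℝ) ^ 2 ≤ 1) (hV : ∀ e ∈ boxEdges 4 (2 * H + 1), linkDefect V e ≤ r₀ ^ 2) :
    IsUnit (fpOperator H V).det ∧
      ∀ w : ↥(interiorSites H) × Fin 3 → ℝ,
        (((fpOperator H V)⁻¹ *ᵥ w) ⬝ᵥ ((fpOperator H V)⁻¹ *ᵥ w)) ≤ (8 * (H : ℝ) ^ 2) ^ 2 * (w ⬝ᵥ w) := by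
  have hH' : (1 : ℝ) ≤ H := by exact_mod_cast hH
  have hH2 : (1 : ℝ) ≤ (H : ℝ) ^ 2 := by nlinarith
  have hH2pos : (0 : ℝ) < (H : ℝ) ^ 2 := by positivity
  have hr1 : r₀ ≤ 1 := by nlinarith
  have hE := fpOperator_sub_one_opBound_of_linkDefect (H := H) V hr₀ hr1 hV
  have hm : (0 : ℝ) ≤ 252 * r₀ := by positivity
  -- `252 r₀ ≤ 1/(8H²) < 1/(4H²)`
  have hm8 : 252 * r₀ ≤ 1 / (8 * (H : ℝ) ^ 2) := by
    rw [le_div_iff₀ (by positivity)]; nlinarith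
  have hgap : 1 / (8 * (H : ℝ) ^ 2) ≤ 1 / 4 / (H : ℝ) ^ 2 - 252 * r₀ := by
    have : 1 / 4 / (H : ℝ) ^ 2 = 1 / (8 * (H : ℝ) ^ 2) + 1 / (8 * (H : ℝ) ^ 2) := by
      field_simp; ring
    rw [this]; linarith
  have hmH : 252 * r₀ < 1 / 4 / (H : ℝ) ^ 2 := by
    have h8 : (0 : ℝ) < 1 / (8 * (H : ℝ) ^ 2) := by positivity
    linarith
  obtain ⟨hU, hK⟩ := SpectralFloor.fpOperator_inv_of_sub_one hH V hm hmH hE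
  refine ⟨hU, fun w => ?_⟩
  have hKw := hK w
  have hX0 : 0 ≤ ((fpOperator H V)⁻¹ *ᵥ w) ⬝ᵥ ((fpOperator H V)⁻¹ *ᵥ w) := Finset.sum_nonneg fun i _ => mul_self_nonneg _
  have h1 : (1 / (8 * (H : ℝ) ^ 2)) ^ 2 * (((fpOperator H V)⁻¹ *ᵥ w) ⬝ᵥ ((fpOperator H V)⁻¹ *ᵥ w)) ≤ w ⬝ᵥ w :=
    (mul_le_mul_of_nonneg_right (pow_le_pow_left₀ (by positivity) hgap 2) hX0).trans hKw
  have hid : ((fpOperator H V)⁻¹ *ᵥ w) ⬝ᵥ ((fpOperator H V)⁻¹ *ᵥ w) =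
      (8 * (H : ℝ) ^ 2) ^ 2 * ((1 / (8 * (H : ℝ) ^ 2)) ^ 2 * (((fpOperator H V)⁻¹ *ᵥ w) ⬝ᵥ ((fpOperator H V)⁻¹ *ᵥ w))) := by
    field_simp
  rw [hid]
  exact mul_le_mul_of_nonneg_left h1 (by positivity)

/-! ## `‖J‖` from `‖1 − J‖` -/

/-- `‖(1 − J)v‖₂ ≤ ε‖v‖₂` for all `v` ⇒ `‖Jv‖₂ ≤ (1 + ε)‖v‖₂` (squared `dotProduct` form). -/
theorem mulVec_opBound_of_one_sub {ι : Type*} [Fintype ι] [DecidableEq ι] (J : Matrix ι ι ℝ) {ε : ℝ} (hε : 0 ≤ ε)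
    (hJ1 : ∀ v : ι → ℝ, ((1 - J) *ᵥ v) ⬝ᵥ ((1 - J) *ᵥ v) ≤ ε ^ 2 * (v ⬝ᵥ v)) (v : ι → ℝ) :
    (J *ᵥ v) ⬝ᵥ (J *ᵥ v) ≤ (1 + ε) ^ 2 * (v ⬝ᵥ v) := by
  have hid : J *ᵥ v = v + -((1 - J) *ᵥ v) := by
    rw [Matrix.sub_mulVec, Matrix.one_mulVec]; abel
  have hv0 : 0 ≤ v ⬝ᵥ v := Finset.sum_nonneg fun i _ => mul_self_nonneg _
  have h1 : Real.sqrt ((J *ᵥ v) ⬝ᵥ (J *ᵥ v)) ≤ (1 + ε) * Real.sqrt (v ⬝ᵥ v) := by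
    rw [hid]
    calc _ ≤ Real.sqrt (v ⬝ᵥ v) + Real.sqrt ((-((1 - J) *ᵥ v)) ⬝ᵥ (-((1 - J) *ᵥ v))) := sqrt_dotProduct_add_le _ _
      _ = Real.sqrt (v ⬝ᵥ v) + Real.sqrt (((1 - J) *ᵥ v) ⬝ᵥ ((1 - J) *ᵥ v)) := by rw [neg_dotProduct_neg]
      _ ≤ Real.sqrt (v ⬝ᵥ v) + ε * Real.sqrt (v ⬝ᵥ v) := add_le_add le_rfl (sqrt_dotProduct_mulVec_le hε hJ1 v)
      _ = (1 + ε) * Real.sqrt (v ⬝ᵥ v) := by ring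
  have h0 : 0 ≤ (J *ᵥ v) ⬝ᵥ (J *ᵥ v) := Finset.sum_nonneg fun i _ => mul_self_nonneg _
  have hsq := pow_le_pow_left₀ (Real.sqrt_nonneg _) h1 2
  rw [Real.sq_sqrt h0, mul_pow, Real.sq_sqrt hv0] at hsq
  exact hsq

/-! ## The matrix-level contraction bound -/

/-- **J2 CORE (matrix level).**  For `H ≥ 1`, `2016·r₀·H² ≤ 1`, `V` with cold-box links within defect `r₀²` of `1`, `‖A_x‖ ≤ a ≤ 1`, and ANY
matrix `J` with `‖(1 − J)w‖₂ ≤ c_J·a·‖w‖₂`: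
`‖(1 − F_V⁻¹·F(V^{pauliGauge A})·J) w‖₂² ≤ ((c_J + 16128·(1 + c_J))·H²·a)²·‖w‖₂²`. -/
theorem orbitMap_contraction_core {H : ℕ} (hH : 1 ≤ H) (V : LGConfig 4 SU2) {r₀ a cJ : ℝ} (hr₀ : 0 ≤ r₀) (ha0 : 0 ≤ a) (ha1 : a ≤ 1)
    (hcJ : 0 ≤ cJ) (hsmall : 2016 * r₀ * (H : ℝ) ^ 2 ≤ 1) (hV : ∀ e ∈ boxEdges 4 (2 * H + 1), linkDefect V e ≤ r₀ ^ 2)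
    (A : ↥(interiorSites H) → EuclideanSpace ℝ (Fin 3)) (hA : ∀ x, ‖A x‖ ≤ a)
    (J : Matrix (↥(interiorSites H) × Fin 3) (↥(interiorSites H) × Fin 3) ℝ)
    (hJ1 : ∀ w : ↥(interiorSites H) × Fin 3 → ℝ, ((1 - J) *ᵥ w) ⬝ᵥ ((1 - J) *ᵥ w) ≤ (cJ * a) ^ 2 * (w ⬝ᵥ w))
    (w : ↥(interiorSites H) × Fin 3 → ℝ) :
    (w - (fpOperator H V)⁻¹ *ᵥ ((fpOperator H (gaugeTransformZd (pauliGauge H A) V) * J) *ᵥ w)) ⬝ᵥ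
        (w - (fpOperator H V)⁻¹ *ᵥ ((fpOperator H (gaugeTransformZd (pauliGauge H A) V) * J) *ᵥ w)) ≤
      ((cJ + 16128 * (1 + cJ)) * (H : ℝ) ^ 2 * a) ^ 2 * (w ⬝ᵥ w) := by
  have hH' : (1 : ℝ) ≤ H := by exact_mod_cast hH
  have hH2 : (1 : ℝ) ≤ (H : ℝ) ^ 2 := by nlinarith
  obtain ⟨hU, hK⟩ := fpOperator_inv_of_linkDefect hH V hr₀ hsmall hV
  have hKF : (fpOperator H V)⁻¹ * fpOperator H V = 1 := Matrix.nonsing_inv_mul _ hU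
  -- `‖F_V − F(W)‖ ≤ 2016 a`
  have hL : ∀ v : ↥(interiorSites H) × Fin 3 → ℝ,
      ((fpOperator H V - fpOperator H (gaugeTransformZd (pauliGauge H A) V)) *ᵥ v) ⬝ᵥ
          ((fpOperator H V - fpOperator H (gaugeTransformZd (pauliGauge H A) V)) *ᵥ v) ≤ (2016 * a) ^ 2 * (v ⬝ᵥ v) := by
    intro v
    have h := fpOperator_pauliGauge_sub_opBound V A ha0 ha1 hA v
    rw [← pauliGauge_eq] at h
    have hneg : fpOperator H V - fpOperator H (gaugeTransformZd (pauliGauge H A) V) =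
        -(fpOperator H (gaugeTransformZd (pauliGauge H A) V) - fpOperator H V) := by abel
    rw [hneg, Matrix.neg_mulVec, neg_dotProduct_neg]
    exact h
  have hJ := mulVec_opBound_of_one_sub J (by positivity : 0 ≤ cJ * a) hJ1
  have hmain := contraction_opBound ((fpOperator H V)⁻¹) (fpOperator H V) (fpOperator H (gaugeTransformZd (pauliGauge H A) V)) J hKF
    (k := 8 * (H : ℝ) ^ 2) (m := 2016 * a) (ε := cJ * a) (j := 1 + cJ * a) (by positivity) (by positivity) (by positivity)
    (by positivity) hK hL hJ1 hJ w
  refine hmain.trans (mul_le_mul_of_nonneg_right ?_ (Finset.sum_nonneg fun i _ => mul_self_nonneg _))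
  refine pow_le_pow_left₀ (by positivity) ?_ 2
  -- `cJ a + 8H²·2016a·(1 + cJ a) ≤ (cJ + 16128(1 + cJ))·H²·a`
  have h1 : cJ * a ≤ cJ * (H : ℝ) ^ 2 * a := by
    have : cJ * a * 1 ≤ cJ * a * (H : ℝ) ^ 2 := mul_le_mul_of_nonneg_left hH2 (by positivity)
    linarith
  have h2 : cJ * a ≤ cJ := by nlinarith
  have h3 : 8 * (H : ℝ) ^ 2 * (2016 * a) * (1 + cJ * a) ≤ 16128 * (1 + cJ) * (H : ℝ) ^ 2 * a := by
    have : 8 * (H : ℝ) ^ 2 * (2016 * a) * (1 + cJ * a) = (16128 * (H : ℝ) ^ 2 * a) * (1 + cJ * a) := by ring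
    rw [this]
    have : (16128 * (H : ℝ) ^ 2 * a) * (1 + cJ * a) ≤ (16128 * (H : ℝ) ^ 2 * a) * (1 + cJ) :=
      mul_le_mul_of_nonneg_left (by linarith) (by positivity)
    linarith
  linarith

/-! ## The flat chart blocks: `‖jac − 1‖ ≤ 858·‖A‖` -/

/-- `Σ_c x_c² ≤ 2‖X(x)‖²` (`X(x)₀₀ = i x₂`, `X(x)₀₁ = i x₀ + x₁`; entries are bounded by the ℓ∞-operator norm). -/
theorem sum_sq_le_two_mul_norm_su2Coord_sq (x : Fin 3 → ℝ) : ∑ c : Fin 3, x c ^ 2 ≤ 2 * ‖su2Coord x‖ ^ 2 := by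
  have h00 := Literature.Analysis.Matrix.norm_apply_le_linfty_opNorm (su2Coord x) 0 0
  have h01 := Literature.Analysis.Matrix.norm_apply_le_linfty_opNorm (su2Coord x) 0 1
  have e00 : ‖su2Coord x 0 0‖ = |x 2| := by
    simp [su2Coord, Complex.norm_I, Complex.norm_real]
  have e01 : ‖su2Coord x 0 1‖ ^ 2 = x 0 ^ 2 + x 1 ^ 2 := by
    have : su2Coord x 0 1 = ⟨x 1, x 0⟩ := by
      apply Complex.ext <;> simp [su2Coord]
    rw [this, Complex.sq_norm, Complex.normSq_mk]; ring
  rw [e00] at h00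
  have h0 : 0 ≤ ‖su2Coord x‖ := norm_nonneg _
  have hsq2 : x 2 ^ 2 ≤ ‖su2Coord x‖ ^ 2 := by
    rw [← sq_abs]; exact pow_le_pow_left₀ (abs_nonneg _) h00 2
  have hsq01 : x 0 ^ 2 + x 1 ^ 2 ≤ ‖su2Coord x‖ ^ 2 := by
    rw [← e01]; exact pow_le_pow_left₀ (norm_nonneg _) h01 2
  simp only [Fin.sum_univ_three]
  linarith

/-- `e^{6s} − 1 ≤ 404·s` for `0 ≤ s ≤ 1` (convexity of `exp` and `e < 2.72`, `2.72⁶ < 405`). -/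
theorem exp_six_mul_sub_one_le {s : ℝ} (hs0 : 0 ≤ s) (hs1 : s ≤ 1) : Real.exp (6 * s) - 1 ≤ 404 * s := by
  have hconv := (convexOn_exp).2 (Set.mem_univ (0 : ℝ)) (Set.mem_univ (6 : ℝ)) (by linarith : (0 : ℝ) ≤ 1 - s) hs0 (by ring)
  simp only [smul_eq_mul, mul_zero, zero_add, Real.exp_zero, mul_one] at hconv
  have he6 : Real.exp 6 ≤ 405 := by
    have h1 := Real.exp_one_lt_d9
    have : Real.exp 6 = Real.exp 1 ^ 6 := by rw [← Real.exp_nat_mul]; norm_num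
    rw [this]
    have h0 : 0 ≤ Real.exp 1 := (Real.exp_pos 1).le
    nlinarith [pow_le_pow_left₀ h0 h1.le 6]
  have : Real.exp (6 * s) = Real.exp (s * 6) := by rw [mul_comm]
  rw [this]
  nlinarith

/-- **The flat chart block is `858‖A‖`-close to the identity**: if `X(z) = gSer(ad(−X(A)))(X(u))` (the `y`-block of the right-trivialised
chart derivative, ✓`chartKDeriv_apply`) and `‖A‖ ≤ s ≤ 1`, then `Σ_c (z_c − u_c)² ≤ (858 s)²·Σ_c u_c²`. -/
theorem jacBlock_sub_sq_le (A : EuclideanSpace ℝ (Fin 3)) {s : ℝ} (hs1 : s ≤ 1) (hA : ‖A‖ ≤ s) (u z : Fin 3 → ℝ)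
    (hz : su2Coord z = gSer ℝ (ad ℝ (-su2Coord (WithLp.ofLp A))) (su2Coord u)) :
    ∑ c : Fin 3, (z c - u c) ^ 2 ≤ (858 * s) ^ 2 * ∑ c : Fin 3, u c ^ 2 := by
  have hs0 : 0 ≤ s := (norm_nonneg A).trans hA
  -- linearity of `X` (entrywise)
  have hsub : su2Coord (z - u) = su2Coord z - su2Coord u := by
    ext i j; fin_cases i <;> fin_cases j <;> simp [su2Coord] <;> ring
  -- `X(z − u) = (gSer − 1)(X u)`
  have hT : su2Coord (z - u) = (gSer ℝ (ad ℝ (-su2Coord (WithLp.ofLp A))) - 1) (su2Coord u) := by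
    rw [hsub, hz]; rfl
  haveI : CompleteSpace (type_of% (ad ℝ (-su2Coord (WithLp.ofLp A)))) := FiniteDimensional.complete ℝ _
  -- norms: `‖ad(−X A)‖ ≤ 2‖X A‖ ≤ 6s`, `‖gSer − 1‖ ≤ (e^{6s} − 1)/2 ≤ 202 s`
  have hXA : ‖su2Coord (WithLp.ofLp A)‖ ≤ 3 * s := (Parity.norm_su2Coord_le A).trans (by linarith)
  have had : ‖ad ℝ (-su2Coord (WithLp.ofLp A))‖ ≤ 6 * s := by
    calc _ ≤ 2 * ‖-su2Coord (WithLp.ofLp A)‖ := norm_ad_le _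
      _ = 2 * ‖su2Coord (WithLp.ofLp A)‖ := by rw [norm_neg]
      _ ≤ 6 * s := by linarith
  have hg : ‖gSer ℝ (ad ℝ (-su2Coord (WithLp.ofLp A))) - 1‖ ≤ 202 * s := by
    calc _ ≤ (Real.exp ‖ad ℝ (-su2Coord (WithLp.ofLp A))‖ - 1) / 2 := norm_gSer_sub_one_le _
      _ ≤ (Real.exp (6 * s) - 1) / 2 := by gcongr
      _ ≤ 202 * s := by linarith [exp_six_mul_sub_one_le hs0 hs1]
  -- `‖X u‖ ≤ 3‖u‖₂`
  have hu2 : ‖(WithLp.toLp 2 u : EuclideanSpace ℝ (Fin 3))‖ = Real.sqrt (∑ c : Fin 3, u c ^ 2) := by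
    rw [EuclideanSpace.norm_eq]
    congr 1
    exact Finset.sum_congr rfl fun c _ => by simp [Real.norm_eq_abs, sq_abs]
  have hXu : ‖su2Coord u‖ ≤ 3 * Real.sqrt (∑ c : Fin 3, u c ^ 2) := by
    have := Parity.norm_su2Coord_le (WithLp.toLp 2 u)
    rw [hu2] at this
    exact this
  have hXzu : ‖su2Coord (z - u)‖ ≤ 606 * s * Real.sqrt (∑ c : Fin 3, u c ^ 2) := by
    rw [hT]
    calc _ ≤ ‖gSer ℝ (ad ℝ (-su2Coord (WithLp.ofLp A))) - 1‖ * ‖su2Coord u‖ := ContinuousLinearMap.le_opNorm _ _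
      _ ≤ (202 * s) * (3 * Real.sqrt (∑ c : Fin 3, u c ^ 2)) := mul_le_mul hg hXu (norm_nonneg _) (by positivity)
      _ = 606 * s * Real.sqrt (∑ c : Fin 3, u c ^ 2) := by ring
  have hsum0 : 0 ≤ ∑ c : Fin 3, u c ^ 2 := Finset.sum_nonneg fun c _ => sq_nonneg _
  have hlow := sum_sq_le_two_mul_norm_su2Coord_sq (z - u)
  simp only [Pi.sub_apply] at hlow
  have hsq : ‖su2Coord (z - u)‖ ^ 2 ≤ (606 * s) ^ 2 * ∑ c : Fin 3, u c ^ 2 := by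
    have := pow_le_pow_left₀ (norm_nonneg _) hXzu 2
    rw [mul_pow, Real.sq_sqrt hsum0] at this
    exact this
  nlinarith

/-- **Block-diagonal sum**: if every `y`-block of `J` is the flat chart block at `(♭⁻¹v)_y` (`X((Jw)_y) = gSer(ad(−X((♭⁻¹v)_y)))(X(w_y))`)
and `‖(♭⁻¹v)_y‖ ≤ a ≤ 1`, then `‖(1 − J)w‖₂² ≤ (858 a)²·‖w‖₂²`. -/
theorem one_sub_jac_opBound {H : ℕ} (v : ↥(interiorSites H) × Fin 3 → ℝ) {a : ℝ} (ha1 : a ≤ 1)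
    (hv : ∀ x, ‖vecToField H v x‖ ≤ a) (J : Matrix (↥(interiorSites H) × Fin 3) (↥(interiorSites H) × Fin 3) ℝ)
    (hJ : ∀ (w : ↥(interiorSites H) × Fin 3 → ℝ) (y : ↥(interiorSites H)),
      su2Coord (fun c => (J *ᵥ w) (y, c)) =
        gSer ℝ (ad ℝ (-su2Coord (WithLp.ofLp (vecToField H v y)))) (su2Coord fun c => w (y, c)))
    (w : ↥(interiorSites H) × Fin 3 → ℝ) :
    ((1 - J) *ᵥ w) ⬝ᵥ ((1 - J) *ᵥ w) ≤ (858 * a) ^ 2 * (w ⬝ᵥ w) := by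
  have hblock : ∀ y : ↥(interiorSites H),
      ∑ c : Fin 3, ((J *ᵥ w) (y, c) - w (y, c)) ^ 2 ≤ (858 * a) ^ 2 * ∑ c : Fin 3, w (y, c) ^ 2 := fun y =>
    jacBlock_sub_sq_le (vecToField H v y) ha1 (hv y) (fun c => w (y, c)) (fun c => (J *ᵥ w) (y, c)) (hJ w y)
  have hl : ((1 - J) *ᵥ w) ⬝ᵥ ((1 - J) *ᵥ w) = ∑ y : ↥(interiorSites H), ∑ c : Fin 3, ((J *ᵥ w) (y, c) - w (y, c)) ^ 2 := by
    rw [dotProduct, Fintype.sum_prod_type]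
    refine Finset.sum_congr rfl fun y _ => Finset.sum_congr rfl fun c _ => ?_
    rw [Matrix.sub_mulVec, Matrix.one_mulVec, Pi.sub_apply]; ring
  have hr : w ⬝ᵥ w = ∑ y : ↥(interiorSites H), ∑ c : Fin 3, w (y, c) ^ 2 := by
    rw [dotProduct, Fintype.sum_prod_type]
    refine Finset.sum_congr rfl fun y _ => Finset.sum_congr rfl fun c _ => ?_
    ring
  rw [hl, hr, Finset.mul_sum]
  exact Finset.sum_le_sum fun y _ => hblock y

/-! ## J2 from J1's derivative formula -/

/-- ★ **J2 REDUCED TO J1's DERIVATIVE FORMULA (matrix letters).**  If for every `H, V, v` the orbit map has derivative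
`toLin' (fpOperator H (V^{pauliGauge ♭⁻¹v}) * J_v)` at `v` for a matrix `J_v` whose `y`-blocks are the flat chart Jacobians
(`X((J_v w)_y) = gSer(ad(−X((♭⁻¹v)_y)))(X(w_y))` — w3's `pauliJac`, via `pauliJac`/`jBlock_apply`/`su2Coord_jPauli`), then `OrbitMapContraction`
holds, with `C = 858 + 16128·859`. -/
theorem orbitMapContraction_of_hasFDerivAt
    (hD : ∀ (H : ℕ) (V : LGConfig 4 SU2) (v : ↥(interiorSites H) × Fin 3 → ℝ),
      ∃ J : Matrix (↥(interiorSites H) × Fin 3) (↥(interiorSites H) × Fin 3) ℝ,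
        (∀ (w : ↥(interiorSites H) × Fin 3 → ℝ) (y : ↥(interiorSites H)),
          su2Coord (fun c => (J *ᵥ w) (y, c)) =
            gSer ℝ (ad ℝ (-su2Coord (WithLp.ofLp (vecToField H v y)))) (su2Coord fun c => w (y, c))) ∧
        HasFDerivAt (orbitMapFlat H V)
          (LinearMap.toContinuousLinearMap
            (Matrix.toLin' (fpOperator H (gaugeTransformZd (pauliGauge H (vecToField H v)) V) * J))) v) :
    OrbitMapContraction := by
  refine ⟨858 + 16128 * (1 + 858), by norm_num, ?_⟩
  intro H hH r₀ a hr₀ ha0 ha1 hC V hV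
  have hsmall : 2016 * r₀ * (H : ℝ) ^ 2 ≤ 1 := by
    have : 2016 * r₀ * (H : ℝ) ^ 2 ≤ (858 + 16128 * (1 + 858)) * r₀ * (H : ℝ) ^ 2 := by
      have h0 : 0 ≤ r₀ * (H : ℝ) ^ 2 := by positivity
      nlinarith
    exact this.trans hC
  refine ⟨(fpOperator_inv_of_linkDefect hH V hr₀ hsmall hV).1, fun v hv w => ?_⟩
  obtain ⟨J, hJ, hderiv⟩ := hD H V v
  -- the derivative, as a matrix product acting on `w`
  have hfd : fderiv ℝ (orbitMapFlat H V) v w =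
      (fpOperator H (gaugeTransformZd (pauliGauge H (vecToField H v)) V) * J) *ᵥ w := by
    rw [hderiv.fderiv, LinearMap.coe_toContinuousLinearMap', Matrix.toLin'_apply]
  rw [hfd]
  exact orbitMap_contraction_core hH V hr₀ ha0 ha1 (by norm_num : (0 : ℝ) ≤ 858) hsmall hV (vecToField H v) hv J
    (one_sub_jac_opBound v ha1 hv J hJ) w

/-! ## J2 by name -/


/-- The `y`-slice of `pauliJac H v *ᵥ w` is the per-site chart Jacobian applied to the `y`-slice of `w`. -/
theorem pauliJac_mulVec_slice (H : ℕ) (v w : ↥(interiorSites H) × Fin 3 → ℝ) (y : ↥(interiorSites H)) :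
    (fun c => (OrbitChart.pauliJac H v *ᵥ w) (y, c)) = OrbitChart.jPauli (WithLp.ofLp (vecToField H v y)) (fun c => w (y, c)) := by
  funext c
  rw [OrbitChart.pauliJac, LinearMap.toMatrix'_mulVec, OrbitChart.jBlock_apply]

/-- ★★ **J2 `OrbitMapContraction`** (the typed Prop of ✓`…OrbitJacobianDefs`, BY NAME). -/
theorem orbitMapContraction : OrbitMapContraction :=
  orbitMapContraction_of_hasFDerivAt fun H V v =>
    ⟨OrbitChart.pauliJac H v, fun w y => by rw [pauliJac_mulVec_slice, OrbitChart.su2Coord_jPauli],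
      OrbitChart.hasFDerivAt_orbitMapFlat_matrix H V v⟩

end Summit.QuantumFields.YangMills.Theorems.AllWindowsColdBoxBoxHighLine

end
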